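import Literature.Geometry.Kaehler.ComplexTorusIntegralHardLefschetzDegreeTwoCokernel
import Literature.Geometry.Kaehler.ComplexTorusMinimalClasses
import Literature.Geometry.Kaehler.ComplexTorusDualPolarizationIsogeny
import Mathlib.GroupTheory.SpecificGroups.Cyclic
import HarnessLib

/-!
# The minimal class `γ_{g−2}` on ALL of `H²(X, ℤ)`: the exact index `[H^{2g−2}(X, ℤ) : γ_{g−2} ∧ H²(X, ℤ)] = (g−1)·∏_{i ≤ g−2} ((d_{g−1}/d_i)(d_g/d_i))^{2g−1}`,
# the order `(g−1)·d_{g−1}/d₁` of the minimal curve class `γ_{g−1}` in the cokernel, and when `γ_{g−1}` generates it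

Layer `Literature/Geometry/Kaehler`, namespace `Literature.Geometry.Kaehler.ComplexTorus`; lane `lit-hodgefound` (Track 2
foundations library), seat p09, generation 40, row g40-#6. THEOREMS ONLY (0 definitions); no named fact, net debt 0. Sequel of
g35-#3 `ComplexTorusIntegralHardLefschetzDegreeTwo` (`[H^{2g−2}(X, ℤ) : θ^{∧(g−2)} ∧ H²(X, ℤ)] = (g−1)·((g−2)!)^{C(2g,2)}·(d₁⋯d_g)^{(g−2)(2g−1)}`),
g35-#4 `ComplexTorusIntegralHardLefschetzDegreeTwoCokernel` (principal type: the cokernel of the divided power `θ^{[g−2]}` is `ℤ/(g−1)`,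
generated by `θ^{[g−1]}`) and g36-#1 `ComplexTorusMinimalClasses` (the content of `θ^{∧q}` is exactly `q!·d₁⋯d_q`; the minimal class
`γ_q = θ^{∧q}/(q!·d₁⋯d_q)` is a primitive integral class).

Sources (the statements being made precise over `ℤ`):

* Lange 2023 §5.4.1 Thm. 5.4.1 (PDF p. 275: hard Lefschetz `L^{g−2} : H² ⥲ H^{2g−2}` over `ℂ`) and (5.22); §2.5.3 Thm. 2.5.16 / Cor. 2.5.17
  (PDF p. 135: `∧^q θ = q! Σ_T (∏_{ν∈T} d_ν) ω_T`); §4.2 Poincaré's formula (PDF p. 204: `[W_{g−d}] = θ^d/d!`); §11.2 (PDF p. 321: the minimal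
  class `θ^{g−1}/(g−1)!`); §1.5.1 (PDF p. 51: types, all lattice values of a form of type `d` lie in `d₁ℤ`); §1.1.3 Lemma 1.1.17 and Exercise 1.1.6 (8);
* Voisin 2002 §6.2.3 Thm. 6.25 (PDF p. 125) and §7.1.2 (PDF p. 134 L31: `L` acts on integral cohomology, hard Lefschetz fails over `ℤ`);
* Benoist–Debarre 2023 §1 (p. 3): "the minimal cohomology class `θ^c/c! ∈ H^{2c}(X, ℤ)`" of a principally polarised abelian variety.

Setting (`g = j + 2`, `θ = ofRealForm η`, symplectic enumeration `e₀` of type `d₁ ∣ ⋯ ∣ d_g` for the Riemann form `η` on `X = E/Φ(ℤ^ι)`).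
For an ARBITRARY type the divided power `θ^{∧(g−2)}/(g−2)!` is not the optimal integral generator of the Lefschetz line: the content of
`θ^{∧(g−2)}` is `(g−2)!·d₁⋯d_{g−2}` (g36-#1), and the honest question over `ℤ` is the cokernel of the MINIMAL class
`γ_{g−2} = θ^{∧(g−2)}/((g−2)!·d₁⋯d_{g−2})` on `H²(X, ℤ)`. Since `θ^{∧(g−2)} ∧ H²(X, ℤ) = c · (γ_{g−2} ∧ H²(X, ℤ))`, `c = (g−2)!·d₁⋯d_{g−2}`,
and `γ_{g−2} ∧ (−)` is injective (hard Lefschetz), `[γ_{g−2} ∧ H² : θ^{∧(g−2)} ∧ H²] = c^{C(2g,2)}` and g35-#3's index divided by it is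

  **`[H^{2g−2}(X, ℤ) : γ_{g−2} ∧ H²(X, ℤ)] = (g−1) · ∏_{i=1}^{g−2} ((d_{g−1}/d_i)·(d_g/d_i))^{2g−1}`**

— e.g. `g − 1` for every CONSTANT type `(k, …, k)` (in particular for a principal polarisation), `2·d^{10}` for a threefold of type
`(1, d, d)`, `2·d⁵` for `(1, 1, d)`; so **`γ_{g−2} ∧ H²(X, ℤ) = H^{2g−2}(X, ℤ)` iff `g = 2`**, and for `g ≥ 3` the cokernel has order divisible
by `g − 1` for every type. Next, with the minimal curve class `γ_{g−1} = θ^{∧(g−1)}/((g−1)!·d₁⋯d_{g−1})`: `γ_{g−2} ∧ θ = (g−1)·d_{g−1} · γ_{g−1}`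
and `θ/d₁ ∈ H²(X, ℤ)` is integral, whence — hard Lefschetz injectivity and evaluation on `(λ₁, μ₁)` as in g35-#4 —

  **`k · γ_{g−1} ∈ γ_{g−2} ∧ H²(X, ℤ) ⟺ (g−1)·(d_{g−1}/d₁) ∣ k`**, i.e. `[γ_{g−2} ∧ H² + ℤγ_{g−1} : γ_{g−2} ∧ H²] = (g−1)·d_{g−1}/d₁`;

comparing with the index: **`H^{2g−2}(X, ℤ) = γ_{g−2} ∧ H²(X, ℤ) + ℤ·γ_{g−1}` (the cokernel is generated by the minimal curve class)
iff the type is constant or `g = 2`**, and then `H^{2g−2}(X, ℤ)/γ_{g−2} ∧ H²(X, ℤ) ≅ ℤ/(g−1)` (g35-#4 is the principal case, stated there for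
`(g−2)!·H^{2g−2}` and `θ^{∧(g−2)}`).

## Contents (theorems only; `g = j + 2`)

* §0 (private) arithmetic: `d₁⋯d_g = d₁⋯d_{g−2}·(d_{g−1}d_g)`, `(d_{g−1}d_g)^{g−2} = (d₁⋯d_{g−2})² · ∏_i (d_{g−1}/d_i)(d_g/d_i)`, the content
  recursion `N_{g−1} = N_{g−2}·((g−1)·d_{g−1})`, the division of g35-#3's index, and the converse inequality.
* §1 `IsSymplecticEnum.mem_integralForms_of_wedgePow_eq_content_smul` (`γ_q` is integral, from g36-#1's existence and uniqueness),
  `wedge_injective_of_wedgePow_eq_smul` (`γ_{g−2} ∧ (−)` is injective on `H²(X, ℂ)`), `IsSymplecticEnum.map_wedge_integralForms_two_le_of_eq_content_smul`,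
  `IsSymplecticEnum.inv_smul_ofRealForm_mem_integralForms_two` (`θ/d₁ ∈ H²(X, ℤ)`).
* §2 **`IsSymplecticEnum.relIndex_map_wedge_integralForms_two_of_eq_content_smul`** (the index above), `…_of_forall_eq` (constant type: `g − 1`),
  `IsSymplecticEnum.succ_dvd_relIndex_map_wedge_integralForms_two_of_eq_content_smul` (`g − 1` divides the order of the cokernel),
  **`IsSymplecticEnum.map_wedge_integralForms_two_eq_integralForms_iff_of_eq_content_smul`** (`= H^{2g−2}(X, ℤ)` iff `g = 2`),
  `IsSymplecticEnum.not_integralForms_le_map_wedge_integralForms_two_of_eq_content_smul` (`g ≥ 3`).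
* §3 `IsSymplecticEnum.wedge_ofRealForm_eq_smul_of_eq_content_smul` (`γ_{g−2} ∧ θ = (g−1)·d_{g−1}·γ_{g−1}`),
  **`IsSymplecticEnum.intCast_smul_mem_map_wedge_integralForms_two_iff_of_eq_content_smul`** (the order of `γ_{g−1}` in the cokernel),
  `IsSymplecticEnum.relIndex_map_wedge_integralForms_two_sup_zmultiples_of_eq_content_smul` (`= (g−1)·d_{g−1}/d₁`).
* §4 **`IsSymplecticEnum.map_wedge_integralForms_two_sup_zmultiples_eq_integralForms_iff_of_eq_content_smul`** (generated by `γ_{g−1}` iff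
  constant type or `g = 2`; both directions separately), **`IsSymplecticEnum.nonempty_addEquiv_quotient_map_wedge_integralForms_two_zmod_of_eq_content_smul`**
  (constant type: `H^{2g−2}(X, ℤ)/γ_{g−2} ∧ H²(X, ℤ) ≃+ ℤ/(g−1)`).
* §5 basis-free forms (any presentation of a polarised torus of type `d`): `IsPolarizationType.…` versions and `exists_minimalClass_…` packages.

## References

* [cite: Lange2023AbelianVarietiesComplex, §5.4.1 Thm. 5.4.1 and (5.22) (PDF p. 275); §2.5.3 Thm. 2.5.16 and Cor. 2.5.17 (PDF p. 135);
  §4.2 (PDF p. 204); §11.2 (PDF p. 321); §1.5.1 (PDF p. 51); §1.1.3 Lemma 1.1.17 and Exercise 1.1.6 (8); §2.1.1 (principal)]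
* [cite: VoisinHodgeI2002, §6.2.3 Thm. 6.25 (PDF p. 125); §7.1.2 (PDF p. 134 L31)]
* [cite: BenoistDebarre2023SmoothSubvarietiesJacobians, §1 (p. 3)]
-/

noncomputable section

open Module Function
open Literature.LinearAlgebra.Alternating

namespace Literature.Geometry.Kaehler.ComplexTorus

section HardLefschetzMinimalClassDegreeTwo

/-! ## §0 Arithmetic of a type (private) -/

/-- `d₁⋯d_g = (d₁⋯d_{g−2}) · (d_{g−1} · d_g)` (`g = j + 2`). [cite: Lange2023AbelianVarietiesComplex, §1.5.1 (PDF p. 51)] -/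
private theorem prod_univ_eq_prod_castLE_mul₄₀ {j : ℕ} (d : Fin (j + 2) → ℕ) (hle : j ≤ j + 2) :
    ∏ ν, d ν = (∏ i : Fin j, d (Fin.castLE hle i)) * (d (Fin.last j).castSucc * d (Fin.last (j + 1))) := by
  rw [Fin.prod_univ_castSucc, Fin.prod_univ_castSucc, mul_assoc]
  rfl

/-- `(d_{g−1} d_g)^{g−2} = (d₁⋯d_{g−2})² · ∏_{i ≤ g−2} (d_{g−1}/d_i)(d_g/d_i)` for a type `d₁ ∣ ⋯ ∣ d_g` (`g = j + 2`).
[cite: Lange2023AbelianVarietiesComplex, §1.5.1 (PDF p. 51)] -/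
private theorem mul_pow_eq_prod_sq_mul₄₀ {j : ℕ} {d : Fin (j + 2) → ℕ} (hd : ∀ i i' : Fin (j + 2), i ≤ i' → d i ∣ d i')
    (hle : j ≤ j + 2) :
    (d (Fin.last j).castSucc * d (Fin.last (j + 1))) ^ j =
      (∏ i : Fin j, d (Fin.castLE hle i)) ^ 2 *
        ∏ i : Fin j, (d (Fin.last j).castSucc / d (Fin.castLE hle i)) * (d (Fin.last (j + 1)) / d (Fin.castLE hle i)) := by
  rw [← Fin.prod_const j (d (Fin.last j).castSucc * d (Fin.last (j + 1))), sq, ← Finset.prod_mul_distrib,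
    ← Finset.prod_mul_distrib]
  refine Finset.prod_congr rfl fun i _ ↦ ?_
  have ha : d (Fin.castLE hle i) ∣ d (Fin.last j).castSucc := hd _ _ (Fin.le_def.2 (show (i : ℕ) ≤ j from i.2.le))
  have hb : d (Fin.castLE hle i) ∣ d (Fin.last (j + 1)) := hd _ _ (Fin.le_last _)
  rw [mul_mul_mul_comm, Nat.mul_div_cancel' ha, Nat.mul_div_cancel' hb]

/-- The content recursion `(g−1)!·d₁⋯d_{g−1} = ((g−2)!·d₁⋯d_{g−2}) · ((g−1)·d_{g−1})` (`g = j + 2`).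
[cite: Lange2023AbelianVarietiesComplex, §1.5.1 (PDF p. 51), §2.5.3 Thm. 2.5.16] -/
private theorem content_succ_eq₄₀ {j : ℕ} (d : Fin (j + 2) → ℕ) (hle : j ≤ j + 2) (hle₁ : j + 1 ≤ j + 2) :
    (j + 1).factorial * ∏ i : Fin (j + 1), d (Fin.castLE hle₁ i) =
      (j.factorial * ∏ i : Fin j, d (Fin.castLE hle i)) * ((j + 1) * d (Fin.last j).castSucc) := by
  rw [Fin.prod_univ_castSucc, Nat.factorial_succ]
  have h1 : ∏ i : Fin j, d (Fin.castLE hle₁ i.castSucc) = ∏ i : Fin j, d (Fin.castLE hle i) := rfl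
  have h2 : d (Fin.castLE hle₁ (Fin.last j)) = d (Fin.last j).castSucc := rfl
  rw [h1, h2]
  ring

/-- The division of g35-#3's index by `[γ ∧ H² : θ^{∧j} ∧ H²] = (j!·P)^{C(2g,2)}`: from `(F·P)^C · X = (j+1)·F^C·(P·u)^{j(2j+3)}`,
`u^j = P²·Q` and `C = C(2j+4, 2) = (j+2)(2j+3)` follows `X = (j+1)·Q^{2j+3}`. [folklore] -/
private theorem index_div_content₄₀ {j F P u Q X : ℕ} (hF : 0 < F) (hP : 0 < P) (hu : u ^ j = P ^ 2 * Q)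
    (h : (F * P) ^ (2 * (j + 2)).choose 2 * X = (j + 1) * F ^ (2 * (j + 2)).choose 2 * (P * u) ^ (j * (2 * j + 3))) :
    X = (j + 1) * Q ^ (2 * j + 3) := by
  have hC : (2 * (j + 2)).choose 2 = j * (2 * j + 3) + 2 * (2 * j + 3) := by
    rw [Nat.choose_two_right]
    refine Nat.div_eq_of_eq_mul_left two_pos ?_
    rw [show 2 * (j + 2) - 1 = 2 * j + 3 by omega]
    ring
  rw [hC] at h
  have h1 : F ^ (j * (2 * j + 3) + 2 * (2 * j + 3)) * (P ^ (j * (2 * j + 3) + 2 * (2 * j + 3)) * X) =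
      F ^ (j * (2 * j + 3) + 2 * (2 * j + 3)) * (P ^ (j * (2 * j + 3) + 2 * (2 * j + 3)) * ((j + 1) * Q ^ (2 * j + 3))) := by
    calc F ^ (j * (2 * j + 3) + 2 * (2 * j + 3)) * (P ^ (j * (2 * j + 3) + 2 * (2 * j + 3)) * X)
        = (F * P) ^ (j * (2 * j + 3) + 2 * (2 * j + 3)) * X := by rw [mul_pow, mul_assoc]
      _ = (j + 1) * F ^ (j * (2 * j + 3) + 2 * (2 * j + 3)) * (P * u) ^ (j * (2 * j + 3)) := h
      _ = F ^ (j * (2 * j + 3) + 2 * (2 * j + 3)) * (P ^ (j * (2 * j + 3) + 2 * (2 * j + 3)) * ((j + 1) * Q ^ (2 * j + 3))) := by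
        rw [mul_pow P u, pow_mul u j, hu, mul_pow, ← pow_mul, pow_add P]
        ring
  exact Nat.eq_of_mul_eq_mul_left (pow_pos hP _) (Nat.eq_of_mul_eq_mul_left (pow_pos hF _) h1)

/-- The converse inequality: for `g ≥ 3` (`j ≥ 1`), `(∏_{i<j} (d_a/d_i)(d_b/d_i))^{2j+3} = d_a/d₁` (`a = g−1`, `b = g`) forces a CONSTANT type
(the factor at `i = 1` already exceeds the right side unless everything is `1`). [folklore] -/
private theorem forall_eq_of_prod_pow_eq_div₄₀ {j : ℕ} {d : Fin (j + 2) → ℕ} (hd : ∀ i i' : Fin (j + 2), i ≤ i' → d i ∣ d i')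
    (hpos : ∀ i, 0 < d i) (hj : 0 < j) (hle : j ≤ j + 2)
    (h : (∏ i : Fin j, (d (Fin.last j).castSucc / d (Fin.castLE hle i)) * (d (Fin.last (j + 1)) / d (Fin.castLE hle i))) ^ (2 * j + 3) =
      d (Fin.last j).castSucc / d 0) :
    ∀ i, d i = d 0 := by
  have hia : ∀ i : Fin j, Fin.castLE hle i ≤ (Fin.last j).castSucc := fun i ↦ Fin.le_def.2 (show (i : ℕ) ≤ j from i.2.le)
  have hda : ∀ i : Fin j, d (Fin.castLE hle i) ∣ d (Fin.last j).castSucc := fun i ↦ hd _ _ (hia i)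
  have hdb : ∀ i : Fin j, d (Fin.castLE hle i) ∣ d (Fin.last (j + 1)) := fun i ↦ hd _ _ (Fin.le_last _)
  have hone : ∀ i ∈ (Finset.univ : Finset (Fin j)),
      1 ≤ (d (Fin.last j).castSucc / d (Fin.castLE hle i)) * (d (Fin.last (j + 1)) / d (Fin.castLE hle i)) := fun i _ ↦
    Nat.mul_pos (Nat.div_pos (Nat.le_of_dvd (hpos _) (hda i)) (hpos _)) (Nat.div_pos (Nat.le_of_dvd (hpos _) (hdb i)) (hpos _))
  have hi₀ : Fin.castLE hle ⟨0, hj⟩ = 0 := Fin.ext (by simp)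
  have hfac : (d (Fin.last j).castSucc / d 0) * (d (Fin.last (j + 1)) / d 0) ≤
      ∏ i : Fin j, (d (Fin.last j).castSucc / d (Fin.castLE hle i)) * (d (Fin.last (j + 1)) / d (Fin.castLE hle i)) := by
    have h1 := Finset.single_le_prod' hone (Finset.mem_univ (⟨0, hj⟩ : Fin j))
    rwa [hi₀] at h1
  have hQpos : 0 < ∏ i : Fin j, (d (Fin.last j).castSucc / d (Fin.castLE hle i)) * (d (Fin.last (j + 1)) / d (Fin.castLE hle i)) :=
    Finset.prod_pos fun i hi ↦ hone i hi
  have hprod := (Finset.prod_eq_one_iff_of_one_le' hone).1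
  generalize hQ : ∏ i : Fin j, (d (Fin.last j).castSucc / d (Fin.castLE hle i)) * (d (Fin.last (j + 1)) / d (Fin.castLE hle i)) = Q
    at h hfac hQpos hprod
  have htb : 0 < d (Fin.last (j + 1)) / d 0 := Nat.div_pos (Nat.le_of_dvd (hpos _) (hd _ _ (Fin.zero_le _))) (hpos 0)
  -- `Q ≤ Q^{2j+3} = d_a/d₁ ≤ (d_a/d₁)(d_b/d₁) ≤ Q`
  have hQle : Q ≤ Q ^ (2 * j + 3) := Nat.le_self_pow (by omega) Q
  have h1 : Q ^ (2 * j + 3) = Q :=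
    le_antisymm (by rw [h]; exact le_trans (Nat.le_mul_of_pos_right _ htb) hfac) hQle
  have hQ1 : Q = 1 := by
    have h2 : Q ^ (2 * j + 2) * Q = 1 * Q := by rw [← pow_succ, h1, one_mul]
    exact ((Nat.pow_eq_one).1 (Nat.eq_of_mul_eq_mul_right hQpos h2)).resolve_right (by omega)
  have hall := hprod hQ1
  -- read off the factors
  have hta1 : d (Fin.last j).castSucc / d 0 = 1 := by rw [← h, hQ1, one_pow]
  have ha0 : d (Fin.last j).castSucc = d 0 := by
    rw [← Nat.div_mul_cancel (hd _ _ (Fin.zero_le _) : d 0 ∣ d (Fin.last j).castSucc), hta1, one_mul]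
  have hai : ∀ i : Fin j, d (Fin.castLE hle i) = d 0 := fun i ↦ by
    have h3 : d (Fin.last j).castSucc / d (Fin.castLE hle i) = 1 := Nat.eq_one_of_mul_eq_one_right (hall i (Finset.mem_univ _))
    rw [← ha0, ← Nat.div_mul_cancel (hda i), h3, one_mul]
  have hb0 : d (Fin.last (j + 1)) = d 0 := by
    have h3 : d (Fin.last (j + 1)) / d (Fin.castLE hle ⟨0, hj⟩) = 1 :=
      Nat.eq_one_of_mul_eq_one_left (hall ⟨0, hj⟩ (Finset.mem_univ _))
    rw [hi₀] at h3
    rw [← Nat.div_mul_cancel (hd _ _ (Fin.zero_le _) : d 0 ∣ d (Fin.last (j + 1))), h3, one_mul]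
  intro ν
  rcases lt_trichotomy (ν : ℕ) j with hlt | heq | hgt
  · rw [show ν = Fin.castLE hle ⟨ν, hlt⟩ from Fin.ext rfl]
    exact hai _
  · rw [show ν = (Fin.last j).castSucc from Fin.ext heq]
    exact ha0
  · rw [show ν = Fin.last (j + 1) from Fin.ext (by rw [Fin.val_last]; omega)]
    exact hb0

variable {ι : Type*} [Fintype ι] [DecidableEq ι] {E : Type*} [NormedAddCommGroup E] [NormedSpace ℂ E]
  (Φ : (ι → ℝ) ≃L[ℝ] E) {j : ℕ} {e₀ : Fin (j + 2) ⊕ Fin (j + 2) ≃ ι} {η : E [⋀^Fin 2]→L[ℝ] ℝ} {d : Fin (j + 2) → ℕ}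

/-! ## §1 The minimal class is integral; `γ_{g−2} ∧ (−)` is injective; `θ/d₁` is integral -/

/-- **The minimal class `γ_q` is integral**: any `γ` with `θ^{∧q} = (q!·d₁⋯d_q)·γ` lies in `H^{2q}(X, ℤ)` — it coincides with the integral
generator of g36-#1 (existence and uniqueness of the divided class). [cite: Lange2023AbelianVarietiesComplex, §2.5.3 Thm. 2.5.16 and Cor. 2.5.17 (PDF p. 135)] [cite: BenoistDebarre2023SmoothSubvarietiesJacobians, §1 (p. 3)] -/
theorem IsSymplecticEnum.mem_integralForms_of_wedgePow_eq_content_smul (h : IsSymplecticEnum Φ e₀ η d) (hη : IsRiemannForm Φ η)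
    {q : ℕ} (hq : q ≤ j + 2) {γ : E [⋀^Fin (2 * q)]→L[ℝ] ℂ}
    (hγ : wedgePow (ofRealForm η) q = ((q.factorial * ∏ i, d (Fin.castLE hq i) : ℕ) : ℂ) • γ) :
    γ ∈ integralForms Φ (2 * q) := by
  obtain ⟨γ', hγ'Z, hγ'⟩ := h.exists_mem_integralForms_wedgePow_eq_content_smul Φ hq
  rwa [h.eq_of_wedgePow_eq_content_smul Φ hη hq hγ hγ']

omit [DecidableEq ι] in
/-- **`γ ∧ (−)` is injective on `H²(X, ℂ)` whenever `θ^{∧(g−2)} = c · γ`** (`g = j + 2`): `γ ∧ x = γ ∧ y` gives `θ^{∧(g−2)} ∧ x = θ^{∧(g−2)} ∧ y`,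
and hard Lefschetz (g35-#4 `eq_of_wedgePow_wedge_eq_of_orientation`). [cite: Lange2023AbelianVarietiesComplex, §5.4.1 Thm. 5.4.1 (PDF p. 275)] [cite: VoisinHodgeI2002, §6.2.3 Thm. 6.25 (PDF p. 125)] -/
theorem wedge_injective_of_wedgePow_eq_smul (e : Fin (2 * (j + 2)) ≃ ι) (hη : IsRiemannForm Φ η) {c : ℂ}
    {γ : E [⋀^Fin (2 * j)]→L[ℝ] ℂ} (hγ : wedgePow (ofRealForm η) j = c • γ) :
    Function.Injective fun x : E [⋀^Fin 2]→L[ℝ] ℂ ↦ γ.wedge x := fun x y hxy ↦ by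
  refine eq_of_wedgePow_wedge_eq_of_orientation Φ e hη ?_
  have hxy' : γ.wedge x = γ.wedge y := hxy
  rw [hγ, wedge_smul_left_complex, wedge_smul_left_complex, hxy']

/-- **`γ_{g−2} ∧ H²(X, ℤ) ⊆ H^{2g−2}(X, ℤ)`** (`γ_{g−2}` is integral, §1, and `H^•(X, ℤ)` is a ring).
[cite: Lange2023AbelianVarietiesComplex, §2.5.3 Cor. 2.5.17 (PDF p. 135), §5.4.1 (5.22) (PDF p. 275)] [cite: VoisinHodgeI2002, §7.1.2 (PDF p. 134 L31)] -/
theorem IsSymplecticEnum.map_wedge_integralForms_two_le_of_eq_content_smul (h : IsSymplecticEnum Φ e₀ η d) (hη : IsRiemannForm Φ η)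
    (hle : j ≤ j + 2) {γ : E [⋀^Fin (2 * j)]→L[ℝ] ℂ}
    (hγ : wedgePow (ofRealForm η) j = ((j.factorial * ∏ i : Fin j, d (Fin.castLE hle i) : ℕ) : ℂ) • γ) :
    (integralForms Φ 2).map (AddMonoidHom.mk' (fun x : E [⋀^Fin 2]→L[ℝ] ℂ ↦ γ.wedge x)
        (ContinuousAlternatingMap.wedge_add_right _)) ≤ integralForms Φ (2 * j + 2) := by
  rintro _ ⟨x, hx, rfl⟩
  exact wedge_mem_integralForms Φ (h.mem_integralForms_of_wedgePow_eq_content_smul Φ hη hle hγ) hx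

/-- **`θ/d₁ ∈ H²(X, ℤ)`**: all lattice values of a form of type `(d₁, …, d_g)` lie in `d₁ℤ` (`d₁ ∣ d_i`).
[cite: Lange2023AbelianVarietiesComplex, §1.5.1 (PDF p. 51), §1.1.3 Lemma 1.1.17] -/
theorem IsSymplecticEnum.inv_smul_ofRealForm_mem_integralForms_two (h : IsSymplecticEnum Φ e₀ η d) (hη : IsRiemannForm Φ η) :
    (((d 0 : ℕ) : ℂ))⁻¹ • ofRealForm η ∈ integralForms Φ 2 := by
  have h0 := h.pos hη 0
  have heq : (((d 0 : ℕ) : ℂ))⁻¹ • ofRealForm η = ofRealForm ((((d 0 : ℕ) : ℝ))⁻¹ • η) := by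
    rw [ofRealForm_smul, Complex.ofReal_inv, Complex.ofReal_natCast]
  rw [heq, ofRealForm_mem_integralForms_two_iff]
  intro m n
  obtain ⟨k, hk⟩ := h.isPolarizationType.exists_eq_first_mul Φ h0 m n
  refine ⟨k, ?_⟩
  rw [ContinuousAlternatingMap.smul_apply, hk, smul_eq_mul, ← mul_assoc,
    inv_mul_cancel₀ (by exact_mod_cast h0.ne' : ((d 0 : ℕ) : ℝ) ≠ 0), one_mul]

/-! ## §2 The exact index `[H^{2g−2}(X, ℤ) : γ_{g−2} ∧ H²(X, ℤ)]` for every type -/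

/-- **Integral hard Lefschetz in degree two with the MINIMAL class — the exact index for every type.** For a Riemann form `η` on
`X = E/Φ(ℤ^ι)` with a symplectic enumeration of type `(d₁, …, d_g)` (`g = j + 2`, `θ = ofRealForm η`) and the minimal class `γ = γ_{g−2}`,
`θ^{∧(g−2)} = ((g−2)!·d₁⋯d_{g−2}) · γ`:

  `[H^{2g−2}(X, ℤ) : γ_{g−2} ∧ H²(X, ℤ)] = (g−1) · ∏_{i=1}^{g−2} ((d_{g−1}/d_i)·(d_g/d_i))^{2g−1}`.

Proof: `θ^{∧(g−2)} ∧ H²(X, ℤ) = γ ∧ (c·H²(X, ℤ))` with `c = (g−2)!·d₁⋯d_{g−2}`, `γ ∧ (−)` is injective (hard Lefschetz), so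
`[γ ∧ H² : θ^{∧(g−2)} ∧ H²] = [H² : c·H²] = c^{C(2g,2)}` (`AddSubgroup.relIndex_map_nsmul`), and g35-#3's
`[H^{2g−2} : θ^{∧(g−2)} ∧ H²] = (g−1)·((g−2)!)^{C(2g,2)}·(d₁⋯d_g)^{(g−2)(2g−1)}` is divided by it using `(d_{g−1}d_g)^{g−2} = (d₁⋯d_{g−2})²·∏_i (d_{g−1}/d_i)(d_g/d_i)`.
E.g. `g − 1` for a constant type, `2·d⁵` for type `(1, 1, d)`, `2·d^{10}` for `(1, d, d)`.
[cite: Lange2023AbelianVarietiesComplex, §5.4.1 Thm. 5.4.1 and (5.22) (PDF p. 275); §2.5.3 Thm. 2.5.16 and Cor. 2.5.17 (PDF p. 135); §1.5.1 (PDF p. 51); §1.1.3 Exercise 1.1.6 (8)] [cite: VoisinHodgeI2002, §6.2.3 Thm. 6.25 (PDF p. 125); §7.1.2 (PDF p. 134 L31)] [cite: BenoistDebarre2023SmoothSubvarietiesJacobians, §1 (p. 3)] -/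
theorem IsSymplecticEnum.relIndex_map_wedge_integralForms_two_of_eq_content_smul (h : IsSymplecticEnum Φ e₀ η d)
    (hη : IsRiemannForm Φ η) (hle : j ≤ j + 2) {γ : E [⋀^Fin (2 * j)]→L[ℝ] ℂ}
    (hγ : wedgePow (ofRealForm η) j = ((j.factorial * ∏ i : Fin j, d (Fin.castLE hle i) : ℕ) : ℂ) • γ) :
    ((integralForms Φ 2).map (AddMonoidHom.mk' (fun x : E [⋀^Fin 2]→L[ℝ] ℂ ↦ γ.wedge x)
        (ContinuousAlternatingMap.wedge_add_right _))).relIndex (integralForms Φ (2 * j + 2)) =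
      (j + 1) * (∏ i : Fin j, (d (Fin.last j).castSucc / d (Fin.castLE hle i)) *
        (d (Fin.last (j + 1)) / d (Fin.castLE hle i))) ^ (2 * j + 3) := by
  classical
  set Lγ : (E [⋀^Fin 2]→L[ℝ] ℂ) →+ (E [⋀^Fin (2 * j + 2)]→L[ℝ] ℂ) := AddMonoidHom.mk'
    (fun x : E [⋀^Fin 2]→L[ℝ] ℂ ↦ γ.wedge x) (ContinuousAlternatingMap.wedge_add_right _) with hLγ
  set Lθ : (E [⋀^Fin 2]→L[ℝ] ℂ) →+ (E [⋀^Fin (2 * j + 2)]→L[ℝ] ℂ) := AddMonoidHom.mk'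
    (fun x : E [⋀^Fin 2]→L[ℝ] ℂ ↦ (wedgePow (ofRealForm η) j).wedge x) (ContinuousAlternatingMap.wedge_add_right _) with hLθ
  have hP0 : 0 < ∏ i : Fin j, d (Fin.castLE hle i) := Finset.prod_pos fun i _ ↦ h.pos hη _
  -- `L_θ = L_γ ∘ (c ·)`, `c = j!·d₁⋯d_j`
  have hcomp : Lγ.comp (nsmulAddMonoidHom (j.factorial * ∏ i : Fin j, d (Fin.castLE hle i))) = Lθ := by
    refine AddMonoidHom.ext fun x ↦ ?_
    rw [AddMonoidHom.comp_apply, nsmulAddMonoidHom_apply, hLγ, hLθ, AddMonoidHom.mk'_apply, AddMonoidHom.mk'_apply,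
      ← Nat.cast_smul_eq_nsmul ℂ (j.factorial * ∏ i : Fin j, d (Fin.castLE hle i)) x, wedge_smul_right_complex, hγ,
      wedge_smul_left_complex]
  have hSθ : (integralForms Φ 2).map Lθ =
      ((integralForms Φ 2).map (nsmulAddMonoidHom (j.factorial * ∏ i : Fin j, d (Fin.castLE hle i)))).map Lγ := by
    rw [AddSubgroup.map_map, hcomp]
  have hinj : Function.Injective Lγ := wedge_injective_of_wedgePow_eq_smul Φ (ilvEnum e₀) hη hγ
  -- `[γ ∧ H² : θ^{∧j} ∧ H²] = [H² : c·H²] = c^{C(2g,2)}`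
  have hrank : ((integralForms Φ 2).map (nsmulAddMonoidHom (j.factorial * ∏ i : Fin j, d (Fin.castLE hle i)))).relIndex
      (integralForms Φ 2) = (j.factorial * ∏ i : Fin j, d (Fin.castLE hle i)) ^ (2 * (j + 2)).choose 2 := by
    haveI := free_integralForms Φ 2
    haveI := finite_integralForms Φ 2
    rw [AddSubgroup.relIndex_map_nsmul]
    congr 1
    refine (finrank_integralForms_eq_choose Φ 2).trans ?_
    rw [← Fintype.card_congr (ilvEnum e₀), Fintype.card_fin]
  have h1 : ((integralForms Φ 2).map Lθ).relIndex ((integralForms Φ 2).map Lγ) =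
      (j.factorial * ∏ i : Fin j, d (Fin.castLE hle i)) ^ (2 * (j + 2)).choose 2 := by
    rw [hSθ, AddSubgroup.relIndex_map_map_of_injective _ _ hinj, hrank]
  have hle₁ : (integralForms Φ 2).map Lθ ≤ (integralForms Φ 2).map Lγ := by
    rw [hSθ]
    refine AddSubgroup.map_mono ?_
    rintro _ ⟨x, hx, rfl⟩
    exact AddSubgroup.nsmul_mem _ hx _
  have hle₂ : (integralForms Φ 2).map Lγ ≤ integralForms Φ (2 * j + 2) :=
    h.map_wedge_integralForms_two_le_of_eq_content_smul Φ hη hle hγ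
  have hθidx : ((integralForms Φ 2).map Lθ).relIndex (integralForms Φ (2 * j + 2)) =
      (j + 1) * j.factorial ^ (2 * (j + 2)).choose 2 * (∏ ν, d ν) ^ (j * (2 * j + 3)) :=
    h.relIndex_map_wedgePow_wedge_integralForms_two_eq_pow Φ hη
  have hmul := AddSubgroup.relIndex_mul_relIndex _ _ _ hle₁ hle₂
  rw [h1, hθidx, prod_univ_eq_prod_castLE_mul₄₀ d hle] at hmul
  exact index_div_content₄₀ (Nat.factorial_pos j) hP0 (mul_pow_eq_prod_sq_mul₄₀ h.dvd hle) hmul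

/-- **Constant type `(k, …, k)` — in particular a principal polarisation: `[H^{2g−2}(X, ℤ) : γ_{g−2} ∧ H²(X, ℤ)] = g − 1`** (`g = j + 2`),
with the minimal class `γ_{g−2} = θ^{∧(g−2)}/((g−2)!·k^{g−2})`: `1` for surfaces, `2` on a p.p. threefold (`θ ∧ (−) : H² → H⁴`), `3` for
`θ^{∧2}/2` on a p.p. fourfold. [cite: Lange2023AbelianVarietiesComplex, §2.1.1, §2.5.3 Cor. 2.5.17 (PDF p. 135), §5.4.1 (5.22) (PDF p. 275)] [cite: VoisinHodgeI2002, §7.1.2 (PDF p. 134 L31)] -/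
theorem IsSymplecticEnum.relIndex_map_wedge_integralForms_two_of_eq_content_smul_of_forall_eq (h : IsSymplecticEnum Φ e₀ η d)
    (hη : IsRiemannForm Φ η) (hle : j ≤ j + 2) {γ : E [⋀^Fin (2 * j)]→L[ℝ] ℂ}
    (hγ : wedgePow (ofRealForm η) j = ((j.factorial * ∏ i : Fin j, d (Fin.castLE hle i) : ℕ) : ℂ) • γ) (hd : ∀ i, d i = d 0) :
    ((integralForms Φ 2).map (AddMonoidHom.mk' (fun x : E [⋀^Fin 2]→L[ℝ] ℂ ↦ γ.wedge x)
        (ContinuousAlternatingMap.wedge_add_right _))).relIndex (integralForms Φ (2 * j + 2)) = j + 1 := by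
  rw [h.relIndex_map_wedge_integralForms_two_of_eq_content_smul Φ hη hle hγ]
  simp only [hd, Nat.div_self (h.pos hη 0), mul_one, Finset.prod_const_one, one_pow]

/-- **`g − 1` divides the order of the cokernel of `γ_{g−2} ∧ (−) : H²(X, ℤ) → H^{2g−2}(X, ℤ)`, for every type** (`g = j + 2`).
[cite: Lange2023AbelianVarietiesComplex, §5.4.1 Thm. 5.4.1 and (5.22) (PDF p. 275), §2.5.3 Cor. 2.5.17] [cite: VoisinHodgeI2002, §7.1.2 (PDF p. 134 L31)] -/
theorem IsSymplecticEnum.succ_dvd_relIndex_map_wedge_integralForms_two_of_eq_content_smul (h : IsSymplecticEnum Φ e₀ η d)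
    (hη : IsRiemannForm Φ η) (hle : j ≤ j + 2) {γ : E [⋀^Fin (2 * j)]→L[ℝ] ℂ}
    (hγ : wedgePow (ofRealForm η) j = ((j.factorial * ∏ i : Fin j, d (Fin.castLE hle i) : ℕ) : ℂ) • γ) :
    j + 1 ∣ ((integralForms Φ 2).map (AddMonoidHom.mk' (fun x : E [⋀^Fin 2]→L[ℝ] ℂ ↦ γ.wedge x)
        (ContinuousAlternatingMap.wedge_add_right _))).relIndex (integralForms Φ (2 * j + 2)) :=
  Dvd.intro _ (h.relIndex_map_wedge_integralForms_two_of_eq_content_smul Φ hη hle hγ).symm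

/-- **`γ_{g−2} ∧ H²(X, ℤ) = H^{2g−2}(X, ℤ)` iff `g = 2`** (`g = j + 2`): even with the optimal integral generator of the Lefschetz line,
integral hard Lefschetz `H²(X, ℤ) ⥲ H^{2g−2}(X, ℤ)` holds for NO polarised torus of dimension `g ≥ 3`, of any type (the index is a multiple of
`g − 1`); for `g = 2` it is the identity. [cite: Lange2023AbelianVarietiesComplex, §5.4.1 Thm. 5.4.1 and (5.22) (PDF p. 275), §2.5.3 Cor. 2.5.17 (PDF p. 135)] [cite: VoisinHodgeI2002, §7.1.2 (PDF p. 134 L31)] -/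
theorem IsSymplecticEnum.map_wedge_integralForms_two_eq_integralForms_iff_of_eq_content_smul (h : IsSymplecticEnum Φ e₀ η d)
    (hη : IsRiemannForm Φ η) (hle : j ≤ j + 2) {γ : E [⋀^Fin (2 * j)]→L[ℝ] ℂ}
    (hγ : wedgePow (ofRealForm η) j = ((j.factorial * ∏ i : Fin j, d (Fin.castLE hle i) : ℕ) : ℂ) • γ) :
    (integralForms Φ 2).map (AddMonoidHom.mk' (fun x : E [⋀^Fin 2]→L[ℝ] ℂ ↦ γ.wedge x)
        (ContinuousAlternatingMap.wedge_add_right _)) = integralForms Φ (2 * j + 2) ↔ j = 0 := by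
  have hidx := h.relIndex_map_wedge_integralForms_two_of_eq_content_smul Φ hη hle hγ
  have hle₂ := h.map_wedge_integralForms_two_le_of_eq_content_smul Φ hη hle hγ
  constructor
  · intro heq
    rw [heq, AddSubgroup.relIndex_self] at hidx
    have h1 := Nat.eq_one_of_mul_eq_one_right hidx.symm
    omega
  · rintro rfl
    refine le_antisymm hle₂ (AddSubgroup.relIndex_eq_one.1 ?_)
    rw [hidx]
    simp

/-- **For `g ≥ 3`, `H^{2g−2}(X, ℤ) ⊄ γ_{g−2} ∧ H²(X, ℤ)`**, for every type. [cite: Lange2023AbelianVarietiesComplex, §5.4.1 (5.22) (PDF p. 275)] [cite: VoisinHodgeI2002, §7.1.2 (PDF p. 134 L31)] -/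
theorem IsSymplecticEnum.not_integralForms_le_map_wedge_integralForms_two_of_eq_content_smul (h : IsSymplecticEnum Φ e₀ η d)
    (hη : IsRiemannForm Φ η) (hj : 1 ≤ j) (hle : j ≤ j + 2) {γ : E [⋀^Fin (2 * j)]→L[ℝ] ℂ}
    (hγ : wedgePow (ofRealForm η) j = ((j.factorial * ∏ i : Fin j, d (Fin.castLE hle i) : ℕ) : ℂ) • γ) :
    ¬ integralForms Φ (2 * j + 2) ≤ (integralForms Φ 2).map (AddMonoidHom.mk' (fun x : E [⋀^Fin 2]→L[ℝ] ℂ ↦ γ.wedge x)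
        (ContinuousAlternatingMap.wedge_add_right _)) := fun hle' ↦ by
  have h0 := (h.map_wedge_integralForms_two_eq_integralForms_iff_of_eq_content_smul Φ hη hle hγ).1
    (le_antisymm (h.map_wedge_integralForms_two_le_of_eq_content_smul Φ hη hle hγ) hle')
  omega

/-! ## §3 The order of the minimal curve class `γ_{g−1}` modulo `γ_{g−2} ∧ H²(X, ℤ)` -/

/-- **`γ_{g−2} ∧ θ = (g−1)·d_{g−1} · γ_{g−1}`** (`g = j + 2`; `θ^{∧(g−2)} = N_{g−2}·γ_{g−2}`, `θ^{∧(g−1)} = N_{g−1}·γ_{g−1}`, `N_q = q!·d₁⋯d_q`,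
`N_{g−1} = N_{g−2}·(g−1)·d_{g−1}`). [cite: Lange2023AbelianVarietiesComplex, §2.5.3 Thm. 2.5.16 and Cor. 2.5.17 (PDF p. 135), §1.5.1 (PDF p. 51)] -/
theorem IsSymplecticEnum.wedge_ofRealForm_eq_smul_of_eq_content_smul (h : IsSymplecticEnum Φ e₀ η d) (hη : IsRiemannForm Φ η)
    (hle : j ≤ j + 2) {γ : E [⋀^Fin (2 * j)]→L[ℝ] ℂ}
    (hγ : wedgePow (ofRealForm η) j = ((j.factorial * ∏ i : Fin j, d (Fin.castLE hle i) : ℕ) : ℂ) • γ)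
    (hle₁ : j + 1 ≤ j + 2) {m : E [⋀^Fin (2 * j + 2)]→L[ℝ] ℂ}
    (hm : wedgePow (ofRealForm η) (j + 1) = (((j + 1).factorial * ∏ i : Fin (j + 1), d (Fin.castLE hle₁ i) : ℕ) : ℂ) • m) :
    γ.wedge (ofRealForm η) = (((j + 1) * d (Fin.last j).castSucc : ℕ) : ℂ) • m := by
  refine smul_right_injective (E [⋀^Fin (2 * j + 2)]→L[ℝ] ℂ) (h.content_ne_zero Φ hη hle) ?_
  change ((j.factorial * ∏ i : Fin j, d (Fin.castLE hle i) : ℕ) : ℂ) • γ.wedge (ofRealForm η) =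
    ((j.factorial * ∏ i : Fin j, d (Fin.castLE hle i) : ℕ) : ℂ) • ((((j + 1) * d (Fin.last j).castSucc : ℕ) : ℂ) • m)
  rw [← wedge_smul_left_complex, ← hγ, ← wedgePow_succ, hm, content_succ_eq₄₀ d hle hle₁, Nat.cast_mul, mul_smul]

/-- **The order of the minimal curve class `γ_{g−1}` modulo `γ_{g−2} ∧ H²(X, ℤ)` is `(g−1)·d_{g−1}/d₁`, for every type**:
`k · γ_{g−1} ∈ γ_{g−2} ∧ H²(X, ℤ) ⟺ (g−1)·(d_{g−1}/d₁) ∣ k` (`g = j + 2`). (`⟸`: `γ_{g−2} ∧ (l·θ/d₁) = l·(g−1)(d_{g−1}/d₁) · γ_{g−1}` with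
`θ/d₁ ∈ H²(X, ℤ)`. `⟹`: `k·γ_{g−1} = γ_{g−2} ∧ x` gives `γ_{g−2} ∧ ((g−1)d_{g−1}·x) = γ_{g−2} ∧ (k·θ)`, so `(g−1)d_{g−1}·x = k·θ` by hard
Lefschetz, and on `(λ₁, μ₁)`: `(g−1)d_{g−1}·x(λ₁, μ₁) = k·d₁` with `x(λ₁, μ₁) ∈ ℤ`.) For `d₁ = 1` and `θ^{∧j}`, `θ^{∧(j+1)}/(j+1)` this is
g35-#4 `intCast_smul_mem_map_wedgePow_wedge_iff`. [cite: Lange2023AbelianVarietiesComplex, §4.2 Poincaré's formula (PDF p. 204), §11.2 (PDF p. 321), §2.5.3 Thm. 2.5.16 (PDF p. 135), §5.4.1 Thm. 5.4.1 (PDF p. 275), §1.5.1 (PDF p. 51), §1.1.3 Lemma 1.1.17] [cite: VoisinHodgeI2002, §7.1.2 (PDF p. 134 L31)] [cite: BenoistDebarre2023SmoothSubvarietiesJacobians, §1 (p. 3)] -/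
theorem IsSymplecticEnum.intCast_smul_mem_map_wedge_integralForms_two_iff_of_eq_content_smul (h : IsSymplecticEnum Φ e₀ η d)
    (hη : IsRiemannForm Φ η) (hle : j ≤ j + 2) {γ : E [⋀^Fin (2 * j)]→L[ℝ] ℂ}
    (hγ : wedgePow (ofRealForm η) j = ((j.factorial * ∏ i : Fin j, d (Fin.castLE hle i) : ℕ) : ℂ) • γ)
    (hle₁ : j + 1 ≤ j + 2) {m : E [⋀^Fin (2 * j + 2)]→L[ℝ] ℂ}
    (hm : wedgePow (ofRealForm η) (j + 1) = (((j + 1).factorial * ∏ i : Fin (j + 1), d (Fin.castLE hle₁ i) : ℕ) : ℂ) • m) (k : ℤ) :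
    (k : ℂ) • m ∈ (integralForms Φ 2).map (AddMonoidHom.mk' (fun x : E [⋀^Fin 2]→L[ℝ] ℂ ↦ γ.wedge x)
        (ContinuousAlternatingMap.wedge_add_right _)) ↔
      (((j + 1) * (d (Fin.last j).castSucc / d 0) : ℕ) : ℤ) ∣ k := by
  have h0 := h.pos hη 0
  have hrs : (j + 1) * d (Fin.last j).castSucc = (j + 1) * (d (Fin.last j).castSucc / d 0) * d 0 := by
    rw [mul_assoc, Nat.div_mul_cancel (h.dvd _ _ (Fin.zero_le _) : d 0 ∣ d (Fin.last j).castSucc)]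
  have hγθ := h.wedge_ofRealForm_eq_smul_of_eq_content_smul Φ hη hle hγ hle₁ hm
  constructor
  · rintro ⟨x, hx, hkx⟩
    change γ.wedge x = (k : ℂ) • m at hkx
    -- `γ ∧ ((g−1)d_{g−1} x) = γ ∧ (k θ)`, so `(g−1)d_{g−1} x = k θ`
    have heq : γ.wedge ((((j + 1) * d (Fin.last j).castSucc : ℕ) : ℂ) • x) = γ.wedge ((k : ℂ) • ofRealForm η) := by
      rw [wedge_smul_right_complex, wedge_smul_right_complex, hkx, hγθ, smul_comm]
    have hx' := wedge_injective_of_wedgePow_eq_smul Φ (ilvEnum e₀) hη hγ heq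
    -- evaluate on `(λ₁, μ₁)`
    obtain ⟨z, hz⟩ := exists_int_apply_pair_of_mem_integralForms_two Φ hx (e₀ (Sum.inl 0)) (e₀ (Sum.inr 0))
    have hev := congrArg (fun f : E [⋀^Fin 2]→L[ℝ] ℂ ↦ f ![Φ (Pi.single (e₀ (Sum.inl 0)) 1), Φ (Pi.single (e₀ (Sum.inr 0)) 1)])
      hx'
    simp only [ContinuousAlternatingMap.smul_apply, hz, h.ofRealForm_apply_pair Φ, smul_eq_mul] at hev
    have hev' : (((j + 1) * (d (Fin.last j).castSucc / d 0) * d 0 : ℕ) : ℤ) * z = k * d 0 := by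
      rw [← hrs]
      exact_mod_cast hev
    refine ⟨z, mul_right_cancel₀ (by exact_mod_cast h0.ne' : ((d 0 : ℕ) : ℤ) ≠ 0) ?_⟩
    rw [← hev']
    push_cast
    ring
  · rintro ⟨l, rfl⟩
    refine ⟨(l : ℂ) • ((((d 0 : ℕ) : ℂ))⁻¹ • ofRealForm η),
      intCast_smul_mem_integralForms Φ (h.inv_smul_ofRealForm_mem_integralForms_two Φ hη) l, ?_⟩
    change γ.wedge ((l : ℂ) • ((((d 0 : ℕ) : ℂ))⁻¹ • ofRealForm η)) = _
    have hd0 : ((d 0 : ℕ) : ℂ) ≠ 0 := by exact_mod_cast h0.ne'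
    have hr : (((j + 1) * d (Fin.last j).castSucc : ℕ) : ℂ) =
        (((j + 1) * (d (Fin.last j).castSucc / d 0) : ℕ) : ℂ) * ((d 0 : ℕ) : ℂ) := by
      rw [hrs, Nat.cast_mul]
    rw [wedge_smul_right_complex, wedge_smul_right_complex, hγθ, smul_smul, smul_smul, hr, Int.cast_mul, Int.cast_natCast]
    congr 1
    field_simp

/-- **`[γ_{g−2} ∧ H²(X, ℤ) + ℤ·γ_{g−1} : γ_{g−2} ∧ H²(X, ℤ)] = (g−1)·d_{g−1}/d₁`** (`g = j + 2`): the index is `[ℤ : ((g−1)d_{g−1}/d₁)ℤ]` through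
`k ↦ k·γ_{g−1}` (§3). [cite: Lange2023AbelianVarietiesComplex, §4.2 (PDF p. 204), §5.4.1 (5.22) (PDF p. 275), §1.5.1 (PDF p. 51)] [cite: BenoistDebarre2023SmoothSubvarietiesJacobians, §1 (p. 3)] -/
theorem IsSymplecticEnum.relIndex_map_wedge_integralForms_two_sup_zmultiples_of_eq_content_smul (h : IsSymplecticEnum Φ e₀ η d)
    (hη : IsRiemannForm Φ η) (hle : j ≤ j + 2) {γ : E [⋀^Fin (2 * j)]→L[ℝ] ℂ}
    (hγ : wedgePow (ofRealForm η) j = ((j.factorial * ∏ i : Fin j, d (Fin.castLE hle i) : ℕ) : ℂ) • γ)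
    (hle₁ : j + 1 ≤ j + 2) {m : E [⋀^Fin (2 * j + 2)]→L[ℝ] ℂ}
    (hm : wedgePow (ofRealForm η) (j + 1) = (((j + 1).factorial * ∏ i : Fin (j + 1), d (Fin.castLE hle₁ i) : ℕ) : ℂ) • m) :
    ((integralForms Φ 2).map (AddMonoidHom.mk' (fun x : E [⋀^Fin 2]→L[ℝ] ℂ ↦ γ.wedge x)
        (ContinuousAlternatingMap.wedge_add_right _))).relIndex
      ((integralForms Φ 2).map (AddMonoidHom.mk' (fun x : E [⋀^Fin 2]→L[ℝ] ℂ ↦ γ.wedge x)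
        (ContinuousAlternatingMap.wedge_add_right _)) ⊔ AddSubgroup.zmultiples m) =
      (j + 1) * (d (Fin.last j).castSucc / d 0) := by
  set S := (integralForms Φ 2).map (AddMonoidHom.mk' (fun x : E [⋀^Fin 2]→L[ℝ] ℂ ↦ γ.wedge x)
    (ContinuousAlternatingMap.wedge_add_right _)) with hS
  set ψ : ℤ →+ (E [⋀^Fin (2 * j + 2)]→L[ℝ] ℂ) := zmultiplesHom _ m with hψ
  have hrange : AddSubgroup.zmultiples m = AddSubgroup.map ψ ⊤ := by
    rw [← AddMonoidHom.range_eq_map, hψ, AddSubgroup.range_zmultiplesHom]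
  have hcomap : S.comap ψ = AddSubgroup.zmultiples ((((j + 1) * (d (Fin.last j).castSucc / d 0) : ℕ) : ℤ)) := by
    ext k
    rw [AddSubgroup.mem_comap, Int.mem_zmultiples_iff, hψ, zmultiplesHom_apply, ← Int.cast_smul_eq_zsmul ℂ]
    exact h.intCast_smul_mem_map_wedge_integralForms_two_iff_of_eq_content_smul Φ hη hle hγ hle₁ hm k
  rw [AddSubgroup.relIndex_sup_left, hrange, ← AddSubgroup.relIndex_comap, hcomap, AddSubgroup.relIndex_top_right,
    Int.index_zmultiples, Int.natAbs_natCast]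

/-! ## §4 When the minimal curve class generates the cokernel; the cyclic quotient for a constant type -/

/-- **Constant type or `g = 2`: `H^{2g−2}(X, ℤ) = γ_{g−2} ∧ H²(X, ℤ) + ℤ·γ_{g−1}`** — the cokernel of the minimal class `γ_{g−2}` on `H²(X, ℤ)`
is generated by the minimal curve class `γ_{g−1}` (`g = j + 2`): both `[H^{2g−2} : γ_{g−2} ∧ H²] = g − 1` (§2) and
`[γ_{g−2} ∧ H² + ℤγ_{g−1} : γ_{g−2} ∧ H²] = g − 1` (§3). For a p.p. threefold: `H⁴(X, ℤ) = θ ∧ H²(X, ℤ) + ℤ·θ²/2`.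
[cite: Lange2023AbelianVarietiesComplex, §4.2 Poincaré's formula (PDF p. 204), §11.2 (PDF p. 321), §2.5.3 Cor. 2.5.17 (PDF p. 135), §5.4.1 Thm. 5.4.1 and (5.22) (PDF p. 275)] [cite: VoisinHodgeI2002, §7.1.2 (PDF p. 134 L31)] [cite: BenoistDebarre2023SmoothSubvarietiesJacobians, §1 (p. 3)] -/
theorem IsSymplecticEnum.map_wedge_integralForms_two_sup_zmultiples_eq_integralForms_of_eq_content_smul (h : IsSymplecticEnum Φ e₀ η d)
    (hη : IsRiemannForm Φ η) (hle : j ≤ j + 2) {γ : E [⋀^Fin (2 * j)]→L[ℝ] ℂ}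
    (hγ : wedgePow (ofRealForm η) j = ((j.factorial * ∏ i : Fin j, d (Fin.castLE hle i) : ℕ) : ℂ) • γ)
    (hle₁ : j + 1 ≤ j + 2) {m : E [⋀^Fin (2 * j + 2)]→L[ℝ] ℂ}
    (hm : wedgePow (ofRealForm η) (j + 1) = (((j + 1).factorial * ∏ i : Fin (j + 1), d (Fin.castLE hle₁ i) : ℕ) : ℂ) • m)
    (hd : j = 0 ∨ ∀ i, d i = d 0) :
    (integralForms Φ 2).map (AddMonoidHom.mk' (fun x : E [⋀^Fin 2]→L[ℝ] ℂ ↦ γ.wedge x)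
        (ContinuousAlternatingMap.wedge_add_right _)) ⊔ AddSubgroup.zmultiples m = integralForms Φ (2 * j + 2) := by
  have hsup := h.relIndex_map_wedge_integralForms_two_sup_zmultiples_of_eq_content_smul Φ hη hle hγ hle₁ hm
  have hidx := h.relIndex_map_wedge_integralForms_two_of_eq_content_smul Φ hη hle hγ
  have hSH := h.map_wedge_integralForms_two_le_of_eq_content_smul Φ hη hle hγ
  have hmH : m ∈ integralForms Φ (2 * j + 2) := h.mem_integralForms_of_wedgePow_eq_content_smul Φ hη hle₁ hm
  set S := (integralForms Φ 2).map (AddMonoidHom.mk' (fun x : E [⋀^Fin 2]→L[ℝ] ℂ ↦ γ.wedge x)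
    (ContinuousAlternatingMap.wedge_add_right _)) with hS
  have hNH : S ⊔ AddSubgroup.zmultiples m ≤ integralForms Φ (2 * j + 2) :=
    sup_le hSH (AddSubgroup.zmultiples_le.2 hmH)
  refine le_antisymm hNH (AddSubgroup.relIndex_eq_one.1 ?_)
  have hmul := AddSubgroup.relIndex_mul_relIndex S (S ⊔ AddSubgroup.zmultiples m) (integralForms Φ (2 * j + 2))
    le_sup_left hNH
  have h1 : S.relIndex (S ⊔ AddSubgroup.zmultiples m) = j + 1 := by
    rw [hsup]
    rcases hd with rfl | hd
    · simp [Nat.div_self (h.pos hη 0)]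
    · rw [hd, Nat.div_self (h.pos hη 0), mul_one]
  have h2 : S.relIndex (integralForms Φ (2 * j + 2)) = j + 1 := by
    rw [hidx]
    rcases hd with rfl | hd
    · simp
    · simp only [hd, Nat.div_self (h.pos hη 0), mul_one, Finset.prod_const_one, one_pow]
  rw [h1, h2] at hmul
  exact Nat.eq_of_mul_eq_mul_left (Nat.succ_pos j) (hmul.trans (mul_one _).symm)

/-- **Conversely, if `γ_{g−1}` generates the cokernel of `γ_{g−2}` on `H²(X, ℤ)` then the type is constant or `g = 2`** (`g = j + 2`):
`H^{2g−2} = γ_{g−2} ∧ H² + ℤγ_{g−1}` forces `[H^{2g−2} : γ_{g−2} ∧ H²] = (g−1)·∏_i ((d_{g−1}/d_i)(d_g/d_i))^{2g−1}` to equal the order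
`(g−1)·d_{g−1}/d₁` of `γ_{g−1}`, impossible for `g ≥ 3` unless `d₁ = ⋯ = d_g`. [cite: Lange2023AbelianVarietiesComplex, §5.4.1 (5.22) (PDF p. 275), §1.5.1 (PDF p. 51)] [cite: VoisinHodgeI2002, §7.1.2 (PDF p. 134 L31)] -/
theorem IsSymplecticEnum.eq_zero_or_forall_eq_of_map_wedge_integralForms_two_sup_zmultiples_eq (h : IsSymplecticEnum Φ e₀ η d)
    (hη : IsRiemannForm Φ η) (hle : j ≤ j + 2) {γ : E [⋀^Fin (2 * j)]→L[ℝ] ℂ}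
    (hγ : wedgePow (ofRealForm η) j = ((j.factorial * ∏ i : Fin j, d (Fin.castLE hle i) : ℕ) : ℂ) • γ)
    (hle₁ : j + 1 ≤ j + 2) {m : E [⋀^Fin (2 * j + 2)]→L[ℝ] ℂ}
    (hm : wedgePow (ofRealForm η) (j + 1) = (((j + 1).factorial * ∏ i : Fin (j + 1), d (Fin.castLE hle₁ i) : ℕ) : ℂ) • m)
    (heq : (integralForms Φ 2).map (AddMonoidHom.mk' (fun x : E [⋀^Fin 2]→L[ℝ] ℂ ↦ γ.wedge x)
        (ContinuousAlternatingMap.wedge_add_right _)) ⊔ AddSubgroup.zmultiples m = integralForms Φ (2 * j + 2)) :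
    j = 0 ∨ ∀ i, d i = d 0 := by
  rcases Nat.eq_zero_or_pos j with hj | hj
  · exact Or.inl hj
  refine Or.inr (forall_eq_of_prod_pow_eq_div₄₀ h.dvd (h.pos hη) hj hle ?_)
  have h1 := h.relIndex_map_wedge_integralForms_two_sup_zmultiples_of_eq_content_smul Φ hη hle hγ hle₁ hm
  rw [heq, h.relIndex_map_wedge_integralForms_two_of_eq_content_smul Φ hη hle hγ] at h1
  exact Nat.eq_of_mul_eq_mul_left (Nat.succ_pos j) h1

/-- **The cokernel of the minimal class `γ_{g−2}` on `H²(X, ℤ)` is generated by the minimal curve class `γ_{g−1}` iff the type is constant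
or `g = 2`** (`g = j + 2`). [cite: Lange2023AbelianVarietiesComplex, §4.2 (PDF p. 204), §11.2 (PDF p. 321), §5.4.1 (5.22) (PDF p. 275), §1.5.1 (PDF p. 51)] [cite: VoisinHodgeI2002, §7.1.2 (PDF p. 134 L31)] [cite: BenoistDebarre2023SmoothSubvarietiesJacobians, §1 (p. 3)] -/
theorem IsSymplecticEnum.map_wedge_integralForms_two_sup_zmultiples_eq_integralForms_iff_of_eq_content_smul (h : IsSymplecticEnum Φ e₀ η d)
    (hη : IsRiemannForm Φ η) (hle : j ≤ j + 2) {γ : E [⋀^Fin (2 * j)]→L[ℝ] ℂ}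
    (hγ : wedgePow (ofRealForm η) j = ((j.factorial * ∏ i : Fin j, d (Fin.castLE hle i) : ℕ) : ℂ) • γ)
    (hle₁ : j + 1 ≤ j + 2) {m : E [⋀^Fin (2 * j + 2)]→L[ℝ] ℂ}
    (hm : wedgePow (ofRealForm η) (j + 1) = (((j + 1).factorial * ∏ i : Fin (j + 1), d (Fin.castLE hle₁ i) : ℕ) : ℂ) • m) :
    (integralForms Φ 2).map (AddMonoidHom.mk' (fun x : E [⋀^Fin 2]→L[ℝ] ℂ ↦ γ.wedge x)
        (ContinuousAlternatingMap.wedge_add_right _)) ⊔ AddSubgroup.zmultiples m = integralForms Φ (2 * j + 2) ↔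
      j = 0 ∨ ∀ i, d i = d 0 :=
  ⟨h.eq_zero_or_forall_eq_of_map_wedge_integralForms_two_sup_zmultiples_eq Φ hη hle hγ hle₁ hm,
    h.map_wedge_integralForms_two_sup_zmultiples_eq_integralForms_of_eq_content_smul Φ hη hle hγ hle₁ hm⟩

/-- **Constant type `(k, …, k)`, in particular a principal polarisation: `H^{2g−2}(X, ℤ)/γ_{g−2} ∧ H²(X, ℤ) ≅ ℤ/(g−1)`**, cyclic,
generated by the minimal curve class `γ_{g−1}` (`g = j + 2`; `ℤ/2` on a p.p. threefold, `ℤ/3` for `θ^{∧2}/2` on a p.p. fourfold). g35-#4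
states the principal case for `(g−2)!·H^{2g−2}` and `θ^{∧(g−2)}`; here the quotient of `H^{2g−2}(X, ℤ)` itself by the optimal class.
[cite: Lange2023AbelianVarietiesComplex, §4.2 Poincaré's formula (PDF p. 204), §11.2 (PDF p. 321), §2.1.1, §2.5.3 Cor. 2.5.17 (PDF p. 135), §5.4.1 Thm. 5.4.1 and (5.22) (PDF p. 275)] [cite: VoisinHodgeI2002, §7.1.2 (PDF p. 134 L31)] [cite: BenoistDebarre2023SmoothSubvarietiesJacobians, §1 (p. 3)] -/
theorem IsSymplecticEnum.nonempty_addEquiv_quotient_map_wedge_integralForms_two_zmod_of_eq_content_smul (h : IsSymplecticEnum Φ e₀ η d)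
    (hη : IsRiemannForm Φ η) (hle : j ≤ j + 2) {γ : E [⋀^Fin (2 * j)]→L[ℝ] ℂ}
    (hγ : wedgePow (ofRealForm η) j = ((j.factorial * ∏ i : Fin j, d (Fin.castLE hle i) : ℕ) : ℂ) • γ) (hd : ∀ i, d i = d 0) :
    Nonempty (↥(integralForms Φ (2 * j + 2)) ⧸ ((integralForms Φ 2).map (AddMonoidHom.mk' (fun x : E [⋀^Fin 2]→L[ℝ] ℂ ↦ γ.wedge x)
        (ContinuousAlternatingMap.wedge_add_right _))).addSubgroupOf (integralForms Φ (2 * j + 2)) ≃+ ZMod (j + 1)) := by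
  classical
  have hle₁ : j + 1 ≤ j + 2 := by omega
  obtain ⟨m, hmH, hm⟩ : ∃ m ∈ integralForms Φ (2 * j + 2), wedgePow (ofRealForm η) (j + 1) =
      (((j + 1).factorial * ∏ i : Fin (j + 1), d (Fin.castLE hle₁ i) : ℕ) : ℂ) • m :=
    h.exists_mem_integralForms_wedgePow_eq_content_smul Φ hle₁
  have hHS := h.map_wedge_integralForms_two_sup_zmultiples_eq_integralForms_of_eq_content_smul Φ hη hle hγ hle₁ hm (Or.inr hd)
  have hcard := h.relIndex_map_wedge_integralForms_two_of_eq_content_smul_of_forall_eq Φ hη hle hγ hd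
  rw [AddSubgroup.relIndex, AddSubgroup.index] at hcard
  set H := integralForms Φ (2 * j + 2) with hH
  set S := (integralForms Φ 2).map (AddMonoidHom.mk' (fun x : E [⋀^Fin 2]→L[ℝ] ℂ ↦ γ.wedge x)
    (ContinuousAlternatingMap.wedge_add_right _)) with hS
  have hgen : ∀ x : ↥H ⧸ S.addSubgroupOf H, x ∈ AddSubgroup.zmultiples (QuotientAddGroup.mk (⟨m, hmH⟩ : ↥H) : ↥H ⧸ S.addSubgroupOf H) := by
    intro x
    induction x using QuotientAddGroup.induction_on with
    | H z =>
      have hz : (z : E [⋀^Fin (2 * j + 2)]→L[ℝ] ℂ) ∈ S ⊔ AddSubgroup.zmultiples m := by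
        rw [hHS]
        exact z.2
      obtain ⟨s, hs, t, ht, hst⟩ := AddSubgroup.mem_sup.1 hz
      obtain ⟨k, rfl⟩ := AddSubgroup.mem_zmultiples_iff.1 ht
      refine AddSubgroup.mem_zmultiples_iff.2 ⟨k, ?_⟩
      rw [← QuotientAddGroup.mk_zsmul, QuotientAddGroup.eq, AddSubgroup.mem_addSubgroupOf, AddSubgroup.coe_add, AddSubgroup.coe_neg,
        AddSubgroup.coe_zsmul, ← hst]
      rw [show -(k • m) + (s + k • m) = s by abel]
      exact hs
  exact ⟨(zmodAddEquivOfGenerator hgen hcard).symm⟩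

/-! ## §5 Basis-free forms: any presentation of a polarised torus of type `(d₁, …, d_g)` -/

/-- **`[H^{2g−2}(X, ℤ) : γ_{g−2} ∧ H²(X, ℤ)] = (g−1)·∏_{i ≤ g−2} ((d_{g−1}/d_i)(d_g/d_i))^{2g−1}` for a polarised torus of type `(d₁, …, d_g)`
presented by ANY lattice basis** (`g = j + 2`): the torus admits a symplectic presentation with the same lattice
(`IsPolarizationType.exists_isSymplecticEnum`) and `Hᵏ(X, ℤ)` depends only on the lattice. [cite: Lange2023AbelianVarietiesComplex, §1.5.1 (PDF p. 51), §2.5.3 Cor. 2.5.17 (PDF p. 135), §5.4.1 Thm. 5.4.1 and (5.22) (PDF p. 275)] [cite: VoisinHodgeI2002, §7.1.2 (PDF p. 134 L31)] -/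
theorem IsPolarizationType.relIndex_map_wedge_integralForms_two_of_eq_content_smul {Φ : (ι → ℝ) ≃L[ℝ] E}
    (hd : IsPolarizationType Φ η d) (hη : IsRiemannForm Φ η) (hle : j ≤ j + 2) {γ : E [⋀^Fin (2 * j)]→L[ℝ] ℂ}
    (hγ : wedgePow (ofRealForm η) j = ((j.factorial * ∏ i : Fin j, d (Fin.castLE hle i) : ℕ) : ℂ) • γ) :
    ((integralForms Φ 2).map (AddMonoidHom.mk' (fun x : E [⋀^Fin 2]→L[ℝ] ℂ ↦ γ.wedge x)
        (ContinuousAlternatingMap.wedge_add_right _))).relIndex (integralForms Φ (2 * j + 2)) =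
      (j + 1) * (∏ i : Fin j, (d (Fin.last j).castSucc / d (Fin.castLE hle i)) *
        (d (Fin.last (j + 1)) / d (Fin.castLE hle i))) ^ (2 * j + 3) := by
  obtain ⟨Φ', hΛ, hs⟩ := hd.exists_isSymplecticEnum Φ
  rw [integralForms_eq_of_range_latticeVec_eq hΛ.symm 2, integralForms_eq_of_range_latticeVec_eq hΛ.symm (2 * j + 2)]
  exact hs.relIndex_map_wedge_integralForms_two_of_eq_content_smul Φ' (hη.of_range_latticeVec_subset hΛ.le) hle hγ

/-- **Existence form: any polarised torus of type `(d₁, …, d_g)` carries the integral minimal class `γ_{g−2}`, `θ^{∧(g−2)} = ((g−2)!·d₁⋯d_{g−2})·γ_{g−2}`,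
with `[H^{2g−2}(X, ℤ) : γ_{g−2} ∧ H²(X, ℤ)] = (g−1)·∏_{i ≤ g−2} ((d_{g−1}/d_i)(d_g/d_i))^{2g−1}`** (`g = j + 2`).
[cite: Lange2023AbelianVarietiesComplex, §2.5.3 Thm. 2.5.16 and Cor. 2.5.17 (PDF p. 135), §5.4.1 (5.22) (PDF p. 275)] [cite: BenoistDebarre2023SmoothSubvarietiesJacobians, §1 (p. 3)] -/
theorem IsPolarizationType.exists_minimalClass_relIndex_map_wedge_integralForms_two {Φ : (ι → ℝ) ≃L[ℝ] E}
    (hd : IsPolarizationType Φ η d) (hη : IsRiemannForm Φ η) (hle : j ≤ j + 2) :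
    ∃ γ ∈ integralForms Φ (2 * j), wedgePow (ofRealForm η) j = ((j.factorial * ∏ i : Fin j, d (Fin.castLE hle i) : ℕ) : ℂ) • γ ∧
      ((integralForms Φ 2).map (AddMonoidHom.mk' (fun x : E [⋀^Fin 2]→L[ℝ] ℂ ↦ γ.wedge x)
          (ContinuousAlternatingMap.wedge_add_right _))).relIndex (integralForms Φ (2 * j + 2)) =
        (j + 1) * (∏ i : Fin j, (d (Fin.last j).castSucc / d (Fin.castLE hle i)) *
          (d (Fin.last (j + 1)) / d (Fin.castLE hle i))) ^ (2 * j + 3) := by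
  obtain ⟨γ, hγZ, hγ⟩ := hd.exists_mem_integralForms_wedgePow_eq_content_smul hle
  exact ⟨γ, hγZ, hγ, hd.relIndex_map_wedge_integralForms_two_of_eq_content_smul hη hle hγ⟩

/-- **`γ_{g−2} ∧ H²(X, ℤ) = H^{2g−2}(X, ℤ)` iff `g = 2`, for a polarised torus of type `(d₁, …, d_g)` presented by any lattice basis** (`g = j + 2`).
[cite: Lange2023AbelianVarietiesComplex, §1.5.1 (PDF p. 51), §5.4.1 (5.22) (PDF p. 275)] [cite: VoisinHodgeI2002, §7.1.2 (PDF p. 134 L31)] -/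
theorem IsPolarizationType.map_wedge_integralForms_two_eq_integralForms_iff_of_eq_content_smul {Φ : (ι → ℝ) ≃L[ℝ] E}
    (hd : IsPolarizationType Φ η d) (hη : IsRiemannForm Φ η) (hle : j ≤ j + 2) {γ : E [⋀^Fin (2 * j)]→L[ℝ] ℂ}
    (hγ : wedgePow (ofRealForm η) j = ((j.factorial * ∏ i : Fin j, d (Fin.castLE hle i) : ℕ) : ℂ) • γ) :
    (integralForms Φ 2).map (AddMonoidHom.mk' (fun x : E [⋀^Fin 2]→L[ℝ] ℂ ↦ γ.wedge x)
        (ContinuousAlternatingMap.wedge_add_right _)) = integralForms Φ (2 * j + 2) ↔ j = 0 := by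
  obtain ⟨Φ', hΛ, hs⟩ := hd.exists_isSymplecticEnum Φ
  rw [integralForms_eq_of_range_latticeVec_eq hΛ.symm 2, integralForms_eq_of_range_latticeVec_eq hΛ.symm (2 * j + 2)]
  exact hs.map_wedge_integralForms_two_eq_integralForms_iff_of_eq_content_smul Φ' (hη.of_range_latticeVec_subset hΛ.le) hle hγ

/-- **The order of `γ_{g−1}` modulo `γ_{g−2} ∧ H²(X, ℤ)` is `(g−1)·d_{g−1}/d₁`, on any presentation of a polarised torus of type `(d₁, …, d_g)`**
(`g = j + 2`). [cite: Lange2023AbelianVarietiesComplex, §4.2 (PDF p. 204), §11.2 (PDF p. 321), §1.5.1 (PDF p. 51), §5.4.1 (5.22) (PDF p. 275)] [cite: BenoistDebarre2023SmoothSubvarietiesJacobians, §1 (p. 3)] -/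
theorem IsPolarizationType.intCast_smul_mem_map_wedge_integralForms_two_iff_of_eq_content_smul {Φ : (ι → ℝ) ≃L[ℝ] E}
    (hd : IsPolarizationType Φ η d) (hη : IsRiemannForm Φ η) (hle : j ≤ j + 2) {γ : E [⋀^Fin (2 * j)]→L[ℝ] ℂ}
    (hγ : wedgePow (ofRealForm η) j = ((j.factorial * ∏ i : Fin j, d (Fin.castLE hle i) : ℕ) : ℂ) • γ)
    (hle₁ : j + 1 ≤ j + 2) {m : E [⋀^Fin (2 * j + 2)]→L[ℝ] ℂ}
    (hm : wedgePow (ofRealForm η) (j + 1) = (((j + 1).factorial * ∏ i : Fin (j + 1), d (Fin.castLE hle₁ i) : ℕ) : ℂ) • m) (k : ℤ) :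
    (k : ℂ) • m ∈ (integralForms Φ 2).map (AddMonoidHom.mk' (fun x : E [⋀^Fin 2]→L[ℝ] ℂ ↦ γ.wedge x)
        (ContinuousAlternatingMap.wedge_add_right _)) ↔
      (((j + 1) * (d (Fin.last j).castSucc / d 0) : ℕ) : ℤ) ∣ k := by
  obtain ⟨Φ', hΛ, hs⟩ := hd.exists_isSymplecticEnum Φ
  rw [integralForms_eq_of_range_latticeVec_eq hΛ.symm 2]
  exact hs.intCast_smul_mem_map_wedge_integralForms_two_iff_of_eq_content_smul Φ' (hη.of_range_latticeVec_subset hΛ.le) hle hγ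
    hle₁ hm k

/-- **The cokernel of `γ_{g−2}` on `H²(X, ℤ)` is generated by `γ_{g−1}` iff the type is constant or `g = 2`, on any presentation of a
polarised torus of type `(d₁, …, d_g)`** (`g = j + 2`). [cite: Lange2023AbelianVarietiesComplex, §4.2 (PDF p. 204), §11.2 (PDF p. 321), §1.5.1 (PDF p. 51), §5.4.1 (5.22) (PDF p. 275)] [cite: VoisinHodgeI2002, §7.1.2 (PDF p. 134 L31)] -/
theorem IsPolarizationType.map_wedge_integralForms_two_sup_zmultiples_eq_integralForms_iff_of_eq_content_smul {Φ : (ι → ℝ) ≃L[ℝ] E}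
    (hd : IsPolarizationType Φ η d) (hη : IsRiemannForm Φ η) (hle : j ≤ j + 2) {γ : E [⋀^Fin (2 * j)]→L[ℝ] ℂ}
    (hγ : wedgePow (ofRealForm η) j = ((j.factorial * ∏ i : Fin j, d (Fin.castLE hle i) : ℕ) : ℂ) • γ)
    (hle₁ : j + 1 ≤ j + 2) {m : E [⋀^Fin (2 * j + 2)]→L[ℝ] ℂ}
    (hm : wedgePow (ofRealForm η) (j + 1) = (((j + 1).factorial * ∏ i : Fin (j + 1), d (Fin.castLE hle₁ i) : ℕ) : ℂ) • m) :
    (integralForms Φ 2).map (AddMonoidHom.mk' (fun x : E [⋀^Fin 2]→L[ℝ] ℂ ↦ γ.wedge x)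
        (ContinuousAlternatingMap.wedge_add_right _)) ⊔ AddSubgroup.zmultiples m = integralForms Φ (2 * j + 2) ↔
      j = 0 ∨ ∀ i, d i = d 0 := by
  obtain ⟨Φ', hΛ, hs⟩ := hd.exists_isSymplecticEnum Φ
  rw [integralForms_eq_of_range_latticeVec_eq hΛ.symm 2, integralForms_eq_of_range_latticeVec_eq hΛ.symm (2 * j + 2)]
  exact hs.map_wedge_integralForms_two_sup_zmultiples_eq_integralForms_iff_of_eq_content_smul Φ'
    (hη.of_range_latticeVec_subset hΛ.le) hle hγ hle₁ hm

/-- **Constant type, any presentation: `H^{2g−2}(X, ℤ)/γ_{g−2} ∧ H²(X, ℤ) ≅ ℤ/(g−1)`** (`g = j + 2`), e.g. for every principally polarised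
complex torus. [cite: Lange2023AbelianVarietiesComplex, §4.2 (PDF p. 204), §2.1.1, §2.5.3 Cor. 2.5.17 (PDF p. 135), §5.4.1 Thm. 5.4.1 and (5.22) (PDF p. 275)] [cite: VoisinHodgeI2002, §7.1.2 (PDF p. 134 L31)] [cite: BenoistDebarre2023SmoothSubvarietiesJacobians, §1 (p. 3)] -/
theorem IsPolarizationType.nonempty_addEquiv_quotient_map_wedge_integralForms_two_zmod_of_eq_content_smul {Φ : (ι → ℝ) ≃L[ℝ] E}
    (hd : IsPolarizationType Φ η d) (hη : IsRiemannForm Φ η) (hle : j ≤ j + 2) {γ : E [⋀^Fin (2 * j)]→L[ℝ] ℂ}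
    (hγ : wedgePow (ofRealForm η) j = ((j.factorial * ∏ i : Fin j, d (Fin.castLE hle i) : ℕ) : ℂ) • γ) (hd₀ : ∀ i, d i = d 0) :
    Nonempty (↥(integralForms Φ (2 * j + 2)) ⧸ ((integralForms Φ 2).map (AddMonoidHom.mk' (fun x : E [⋀^Fin 2]→L[ℝ] ℂ ↦ γ.wedge x)
        (ContinuousAlternatingMap.wedge_add_right _))).addSubgroupOf (integralForms Φ (2 * j + 2)) ≃+ ZMod (j + 1)) := by
  obtain ⟨Φ', hΛ, hs⟩ := hd.exists_isSymplecticEnum Φ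
  rw [integralForms_eq_of_range_latticeVec_eq hΛ.symm 2, integralForms_eq_of_range_latticeVec_eq hΛ.symm (2 * j + 2)]
  exact hs.nonempty_addEquiv_quotient_map_wedge_integralForms_two_zmod_of_eq_content_smul Φ' (hη.of_range_latticeVec_subset hΛ.le)
    hle hγ hd₀

/-- **Existence form, constant type: on any polarised torus of constant type `(k, …, k)` and dimension `g = j + 2` there is the integral
minimal class `γ_{g−2}`, `θ^{∧(g−2)} = ((g−2)!·k^{g−2})·γ_{g−2}`, with `H^{2g−2}(X, ℤ)/γ_{g−2} ∧ H²(X, ℤ) ≅ ℤ/(g−1)`.**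
[cite: Lange2023AbelianVarietiesComplex, §4.2 (PDF p. 204), §2.5.3 Thm. 2.5.16 and Cor. 2.5.17 (PDF p. 135), §5.4.1 (5.22) (PDF p. 275)] [cite: BenoistDebarre2023SmoothSubvarietiesJacobians, §1 (p. 3)] -/
theorem IsPolarizationType.exists_minimalClass_nonempty_addEquiv_quotient_map_wedge_integralForms_two_zmod {Φ : (ι → ℝ) ≃L[ℝ] E}
    (hd : IsPolarizationType Φ η d) (hη : IsRiemannForm Φ η) (hle : j ≤ j + 2) (hd₀ : ∀ i, d i = d 0) :
    ∃ γ ∈ integralForms Φ (2 * j), wedgePow (ofRealForm η) j = ((j.factorial * ∏ i : Fin j, d (Fin.castLE hle i) : ℕ) : ℂ) • γ ∧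
      Nonempty (↥(integralForms Φ (2 * j + 2)) ⧸ ((integralForms Φ 2).map (AddMonoidHom.mk' (fun x : E [⋀^Fin 2]→L[ℝ] ℂ ↦ γ.wedge x)
        (ContinuousAlternatingMap.wedge_add_right _))).addSubgroupOf (integralForms Φ (2 * j + 2)) ≃+ ZMod (j + 1)) := by
  obtain ⟨γ, hγZ, hγ⟩ := hd.exists_mem_integralForms_wedgePow_eq_content_smul hle
  exact ⟨γ, hγZ, hγ, hd.nonempty_addEquiv_quotient_map_wedge_integralForms_two_zmod_of_eq_content_smul hη hle hγ hd₀⟩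

end HardLefschetzMinimalClassDegreeTwo

end Literature.Geometry.Kaehler.ComplexTorus
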